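import Summits.QuantumFields.BalabanUV.Beta.CapRouteAWordsRecords

/-!
# Beta / CapWordListGL — THE WORD LIST OF THE LANE'S FUNCTIONAL `G_L`, TYPED AS DATA: 3 + 99 alternating trace words with coefficients
# `±½`, as READ from cap3-g19's ANSWER Q-an5g26-1 (journal l.19104); the word-sum typed target specialised to it
# (β sub-cell, BINDER-OWNERS row CAP-k, lineage `b2b-balaban-beta-an5`, gen 26; node BETA-an5-g26-SCHEDULES, leaf 10; journal l.19047 ∕ l.19104 ∕ l.19459)

cap3-g19 (l.19104, source of record = the lane's integrand code `capsplit_job.py` over `tables5.py` v0.4 built from cap5's exact dumps):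
«G_L(q) = ½·(t₁ᴸ − t₂), t₁ᴸ = Σ_{x∈{A,C,D}} tr(X·k_st^{(L,x)}) (3 one-letter words), t₂ = Σ_{x,y∈{A,C,D}} Σ_{(a,b)∈{(0,3),(1,2),(2,1),(3,0)}}
tr(X·ks_a^{(x)}·Y_b^{(y)}) … Y₀ = X kt₀, Y₁ = X kt₁ − X k₁ X kt₀, Y₂ = X kt₂ − X k₂ X kt₀, Y₃ = X kt₃ − X k₁ X kt₂ − X k₂ X kt₁ − X k₁₂ X kt₀
+ X k₁ X k₂ X kt₀ + X k₂ X k₁ X kt₀ (X = k₀(q)⁻¹): every word is X T₁ X T₂ ⋯ X T_m with X-degree m = 1 (t₁) or 2, 3, 4 (t₂) — NO two tables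
are ever adjacent …; 99 cyclic words after expansion; coefficients ±½ before the i-bookkeeping» and «EVERY stencil component is PURELY REAL or
PURELY IMAGINARY (one-momentum-label components i·ℚ, zero- or two-label components ℚ) … after moving the i's into the coefficients ALL c_w ARE
REAL (±½) and ALL letters are MatConjSymm real tables».  THIS LEAF types that word list as DATA:

* §1 the ALPHABET `Letter` (30 letter families: `kst x`, `ks a x`, `kt b y`, `k1`, `k2`, `k12`; `x, y ∈ {A, C, D}`, `a, b ∈ Fin 4` = momentum-label
  code `0, p₁, p₂, p₁p₂`); `Letter.imag` (the one-label letters `ks 1 ·, ks 2 ·, kt 1 ·, kt 2 ·, k1, k2` — purely imaginary tables, read here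
  through their REAL versions `T̃ := −i·T`, so a word with two of them picks up `i² = −1`);
* §2 the WORD LIST over `ℤ` (`wordListGLz`: the jet expansion `yWords`, the 36 `(x, y, (a,b))` terms, the i-sign `isign`) and over `ℝ`
  (`wordListGL`, coefficients `c∕2`); kernel-decided SHAPE FACTS: `length = 102` (3 + 99), every word has X-degree `1 ≤ m ≤ 4`, every word has 0
  or 2 imaginary letters (`decide`);
* §3 **`gL A T := wordSum A T wordListGL`** and the typed target specialised to it: **`rowsGL_ofRecords_ofPairedBall`** =
  `CapRouteAWordsRecords.rowsOfWordSumCode16E_ofRecords_ofPairedBall wordListGL` — binders: (N) `hb : b 0 = Re ∫ GL`, the 30 letter families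
  `T : Letter → _` with `MatTubeHol` ∕ `MatConjSymm` (typed tables, cap3 (ii) EXPORT) and their vertex-tori sups `S`, `MatTubeHol`∕`MatNegTranspose`∕
  `MatConjSymm` of `A = k₀`, `hR`, schedule + box records, fin schedules + leaves, the paired real ball, (A) with `M := wordSumBound n Ba S wordListGL`
  (an explicit polynomial in `Ba` and the 30 sups, degrees 1–4 in `Ba`), cmp.

WHAT THIS IS ∕ IS NOT.  `wordListGL` is a TRANSCRIPTION of cap3-g19's description of the LANE's functional of record (CAP-KERNEL §4.22 (c)(d),
§4.20), written by an5 for cross-reading by cap3 ∕ cap4 (engine D's own word list, cap4-g19 NEXT (2)); it is DATA, it asserts nothing — in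
particular NOT that `∫ G_L` is Bałaban's β⁰ at `k = 0` (the (N) dictionary is row D1's ∕ G-an2-4's), NOT any table, NOT any number.  The letter
families are NOT typed here.  If the cross-read changes a sign or a letter, a v1.1 replaces the list (it is consumed only through `gL`).

HONEST FRAMING.  Kernel data + glue; 0 binders instantiated; 0 certified coefficients.  Discharging `BetaPertH` would make Bałaban's ultraviolet
stability unconditional — NOT the continuum limit, NOT the Clay problem.  HONEST DEPENDENCY: continuum YM on T⁴ ⇐ BetaPertH ∧ nine spine estimates
(0/9 proved); BetaPertH ⇐ (D1) ∧ (D4) ∧ CAP+tail; G-an2-4 gates asym, D1 and NE2/3/4.  0 `sorry`, 0 cite tags.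
-/

namespace Summit.QuantumFields.BalabanUV.Beta.CapWordListGL

open Complex Set Matrix
open Literature.MathematicalPhysics.QuantumFieldTheory.Balaban1983to89
open B4Strip (Strip)
open B4ContourShift (latticeKernel)
open B4TorusKernel (descend gridPt)
open Beta.AliasingTailL1 (aliasRatioL1)
open Beta.AliasingTailLattice (codeTheta code16SetE)
open Summit.QuantumFields.BalabanUV.Beta.CapRows (Rows)
open Summit.QuantumFields.BalabanUV.Beta.TubeMaximumModulus
open Summit.QuantumFields.BalabanUV.Beta.VertexToriSymmetry
open Summit.QuantumFields.BalabanUV.Beta.ConjReflectionAlgebra (MatConjSymm)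
open Summit.QuantumFields.BalabanUV.Beta.ResolventBoxCertificate (Box)
open Summit.QuantumFields.BalabanUV.Beta.CoverSchedules
open Summit.QuantumFields.BalabanUV.Beta.ResolventLeafRecord (BlockLeafRecord quarterBoxesQ)
open Summit.QuantumFields.BalabanUV.Beta.CapRouteAWords
open Summit.QuantumFields.BalabanUV.Beta.CapRouteAWordsRecords
open scoped Real Matrix.Norms.L2Operator

/-! ## §1 The alphabet -/

/-- the three table tags `x, y ∈ {A, C, D}` of the lane's assembly. [folklore] -/
inductive Tag
  /-- tag `A`. -/ | A
  /-- tag `C`. -/ | C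
  /-- tag `D`. -/ | D
  deriving DecidableEq, Repr

/-- **THE ALPHABET** of `G_L`: `kst x` = `k_st^{(L,x)}`; `ks a x` = the source jet `ks_a^{(x)}` (`a` = momentum-label code `0, p₁, p₂, p₁p₂`);
`kt b y` = the sink jet `kt_b^{(y)}`; `k1`, `k2`, `k12` = the derivative tables of `k₀`.  Each letter stands for the REAL version of its table
(`T̃ := −i·T` for the purely imaginary one-label tables). [folklore] -/
inductive Letter
  /-- `k_st^{(L,x)}` (two-label, real). -/ | kst (x : Tag)
  /-- `ks_a^{(x)}` (label code `a`). -/ | ks (a : Fin 4) (x : Tag)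
  /-- `kt_b^{(y)}` (label code `b`). -/ | kt (b : Fin 4) (y : Tag)
  /-- `k₁` (label `p₁`, imaginary). -/ | k1
  /-- `k₂` (label `p₂`, imaginary). -/ | k2
  /-- `k₁₂` (label `p₁p₂`, real). -/ | k12
  deriving DecidableEq, Repr

/-- the ONE-LABEL letters (purely imaginary tables, read through `T̃ = −i·T`). [folklore] -/
def Letter.imag : Letter → Bool
  | .ks a _ => a = 1 ∨ a = 2
  | .kt b _ => b = 1 ∨ b = 2
  | .k1 => true
  | .k2 => true
  | _ => false

/-! ## §2 The word list -/

/-- the tags as a list. [folklore] -/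
def tags : List Tag := [.A, .C, .D]

/-- the `(a, b)` label splittings of `t₂`: `(0,3), (1,2), (2,1), (3,0)`. [folklore] -/
def pairs : List (Fin 4 × Fin 4) := [(0, 3), (1, 2), (2, 1), (3, 0)]

/-- THE JET EXPANSION `Y_b^{(y)}` as signed words (the leading `X` of every letter is implicit in `wordProd`):
`Y₀ = [kt₀]`, `Y₁ = [kt₁] − [k₁, kt₀]`, `Y₂ = [kt₂] − [k₂, kt₀]`, `Y₃ = [kt₃] − [k₁, kt₂] − [k₂, kt₁] − [k₁₂, kt₀] + [k₁, k₂, kt₀] + [k₂, k₁, kt₀]`.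
[folklore] -/
def yWords (b : Fin 4) (y : Tag) : List (ℤ × List Letter) :=
  match b with
  | 0 => [(1, [.kt 0 y])]
  | 1 => [(1, [.kt 1 y]), (-1, [.k1, .kt 0 y])]
  | 2 => [(1, [.kt 2 y]), (-1, [.k2, .kt 0 y])]
  | 3 => [(1, [.kt 3 y]), (-1, [.k1, .kt 2 y]), (-1, [.k2, .kt 1 y]), (-1, [.k12, .kt 0 y]), (1, [.k1, .k2, .kt 0 y]),
      (1, [.k2, .k1, .kt 0 y])]

/-- the number of imaginary letters of a word. [folklore] -/
def imagCount (w : List Letter) : ℕ := (w.filter fun l => l.imag).length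

/-- the i-SIGN of a word: two imaginary letters `(iT̃)(iT̃′)` contribute `i² = −1`. [folklore] -/
def isign (w : List Letter) : ℤ := if imagCount w = 2 then -1 else 1

/-- the `t₁ᴸ` words: `[kst x]`, integer coefficient `+1` (times the overall `½`). [folklore] -/
def t1Wordsz : List (ℤ × List Letter) := tags.map fun x => (1, [.kst x])

/-- the `t₂` words: for `x, y, (a,b)` and each signed jet word `(s, w)` of `Y_b^{(y)}`, the word `ks_a^{(x)} :: w` with integer coefficient
`−s · isign` (the `−` of `½(t₁ − t₂)`, times the overall `½`). [folklore] -/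
def t2Wordsz : List (ℤ × List Letter) :=
  tags.flatMap fun x => tags.flatMap fun y => pairs.flatMap fun ab =>
    (yWords ab.2 y).map fun sw => (-(sw.1 * isign (Letter.ks ab.1 x :: sw.2)), Letter.ks ab.1 x :: sw.2)

/-- **THE WORD LIST OF `G_L` OVER `ℤ`** (coefficients to be halved). [folklore] -/
def wordListGLz : List (ℤ × List Letter) := t1Wordsz ++ t2Wordsz

/-- **THE WORD LIST OF `G_L`**: real coefficients `c∕2 ∈ {±½}`. [folklore] -/
noncomputable def wordListGL : List (ℝ × List Letter) := wordListGLz.map fun cw => ((cw.1 : ℝ) / 2, cw.2)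

/-- SHAPE: `3 + 99 = 102` words. [folklore] -/
theorem length_wordListGLz : wordListGLz.length = 102 := by decide

/-- SHAPE: the `t₂` part has the «99 cyclic words». [folklore] -/
theorem length_t2Wordsz : t2Wordsz.length = 99 := by decide

/-- SHAPE: every word has X-degree between 1 and 4. [folklore] -/
theorem degree_wordListGLz : ∀ cw ∈ wordListGLz, 1 ≤ cw.2.length ∧ cw.2.length ≤ 4 := by decide

/-- SHAPE: every word has 0 or 2 imaginary letters (so every coefficient is real after the i-bookkeeping). [folklore] -/
theorem imagCount_wordListGLz : ∀ cw ∈ wordListGLz, imagCount cw.2 = 0 ∨ imagCount cw.2 = 2 := by decide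

/-- SHAPE: every integer coefficient is `±1` (so every real coefficient is `±½`). [folklore] -/
theorem coeff_wordListGLz : ∀ cw ∈ wordListGLz, cw.1 = 1 ∨ cw.1 = -1 := by decide

/-- the real list has the same length. [folklore] -/
theorem length_wordListGL : wordListGL.length = 102 := by
  rw [wordListGL, List.length_map, length_wordListGLz]

/-! ## §3 `G_L` as a word sum and the typed target specialised to it -/

noncomputable section

variable {n : Type*} [Fintype n] [DecidableEq n]

/-- **`G_L` AS A WORD SUM**: `gL A T q = Σ_{(c,w) ∈ wordListGL} c · tr(wordProd A T w q)` for a resolvent family `A = k₀` and letter families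
`T : Letter → _` (the REAL versions of the lane's 30 stencil tables). [folklore] -/
def gL (A : (Fin 4 → ℂ) → Matrix n n ℂ) (T : Letter → (Fin 4 → ℂ) → Matrix n n ℂ) (q : Fin 4 → ℂ) : ℂ := wordSum A T wordListGL q

variable {b : ℕ → ℝ} {A : (Fin 4 → ℂ) → Matrix n n ℂ} {T : Letter → (Fin 4 → ℂ) → Matrix n n ℂ} {κ Ba : ℝ} {S : Letter → ℝ}
variable {v u : Type*} [Fintype v] [Fintype u] [DecidableEq v] [DecidableEq u]

/-- **THE TYPED TARGET ON THE LANE'S FUNCTIONAL SHAPE**: `CapRouteAWordsRecords.rowsOfWordSumCode16E_ofRecords_ofPairedBall` at `W := wordListGL` —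
(N) `hb : b 0 = Re ∫ G_L`; STRUCTURE of `A = k₀` and of the 30 letter families; REALITY `MatConjSymm` of both; `hR`; box schedule + records;
fin schedules + leaves; table sups `S`; the engines' PAIRED real ball; (A) with `M := wordSumBound n Ba S wordListGL`; cmp. [folklore] -/
def rowsGL_ofRecords_ofPairedBall (hb : b 0 = (latticeKernel (gL A T) 0).re) (hκ : 0 < κ)
    (hA : MatTubeHol A (fun _ => κ)) (hT' : ∀ i, MatTubeHol (T i) (fun _ => κ)) (hAn : MatNegTranspose A)
    (hAc : MatConjSymm A) (rT : ∀ i, MatConjSymm (T i))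
    {R : ℚ} (hRπ : π ≤ (R : ℝ)) (ν₀ ν₁ : Fin (3 + 1)) (S' : (Fin (3 + 1) → Bool) → Sched 3)
    (rec : (Fin (3 + 1) → ℂ) × (Fin (3 + 1) → ℝ) → BlockLeafRecord 3)
    (hvalid : ∀ bx ∈ quarterBoxesQ (fun _ : Fin (3 + 1) => κ) R ν₀ ν₁ S', (rec bx).Valid ∧ ((rec bx).B : ℝ) ≤ Ba)
    (hsub : ∀ bx ∈ quarterBoxesQ (fun _ : Fin (3 + 1) => κ) R ν₀ ν₁ S', Box bx.1 bx.2 ⊆ (rec bx).box)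
    (e : v ⊕ u ≃ n) (G : (Fin (3 + 1) → ℂ) → Matrix v v ℂ) (X : (Fin (3 + 1) → ℂ) → Matrix v u ℂ)
    (Y : (Fin (3 + 1) → ℂ) → Matrix u v ℂ) (Z : (Fin (3 + 1) → ℂ) → Matrix u u ℂ)
    (hG : ∀ bx ∈ quarterBoxesQ (fun _ : Fin (3 + 1) => κ) R ν₀ ν₁ S', ∀ q ∈ (rec bx).box,
      (A q).submatrix e e * fromBlocks (G q) (X q) (Y q) (Z q) = 1)
    (hsup : ∀ bx ∈ quarterBoxesQ (fun _ : Fin (3 + 1) => κ) R ν₀ ν₁ S',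
      (∀ q ∈ (rec bx).box, ‖G q‖ ≤ (rec bx).a) ∧ (∀ q ∈ (rec bx).box, ‖X q‖ ≤ (rec bx).b) ∧
      (∀ q ∈ (rec bx).box, ‖Y q‖ ≤ (rec bx).c') ∧ (∀ q ∈ (rec bx).box, ‖Z q‖ ≤ (rec bx).e'))
    (hRfl : ∀ (ν : Fin (3 + 1)) (p : Fin (3 + 1) → ℂ), (A (reflectAt ν p)).det = (A p).det)
    (F : Fin (3 + 1) → Sched 1)
    (hcertF : ∀ (i : Fin (3 + 1)), ∀ bx ∈ finRects (F i), ∀ τ x : ℝ, |τ - bx.1 0| ≤ bx.2 0 → |x - bx.1 1| ≤ bx.2 1 →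
      IsUnit (A (i.insertNth ((x : ℂ) + ((τ * κ : ℝ) : ℂ) * I) fun _ => ((τ * κ : ℝ) : ℂ) * I)).det)
    (hS : ∀ i, ∀ q ∈ VertexTori (fun _ : Fin (3 + 1) => κ), ‖T i q‖ ≤ S i)
    {N : ℕ} (hN : 1 ≤ N) [NeZero (4 * N)] (S₀ Rp : Finset (Fin (3 + 1) → Fin (4 * N)))
    (hdec : code16SetE N = S₀ ∪ Rp ∪ Rp.image (fun w => -w)) (hd₁ : Disjoint S₀ Rp)
    (hd₂ : Disjoint S₀ (Rp.image fun w => -w)) (hd₃ : Disjoint Rp (Rp.image fun w => -w)) {t r : ℝ}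
    (hTpair : |((code16SetE N).card : ℝ)⁻¹ *
        (∑ w ∈ S₀, (descend (gL A T) (gridPt (4 * N) w)).re + 2 * ∑ w ∈ Rp, (descend (gL A T) (gridPt (4 * N) w)).re) - t| ≤ r)
    {A₀ : ℝ} (hA₀ : wordSumBound n Ba S wordListGL * codeTheta (aliasRatioL1 κ N) ≤ A₀) (lo : ℚ)
    (hlo : ((lo : ℚ) : ℝ) ≤ t - r - A₀) : Rows b :=
  rowsOfWordSumCode16E_ofRecords_ofPairedBall wordListGL hb hκ hA hT' hAn hAc rT hRπ ν₀ ν₁ S' rec hvalid hsub e G X Y Z hG hsup hRfl F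
    hcertF hS hN S₀ Rp hdec hd₁ hd₂ hd₃ hTpair hA₀ lo hlo

end

end Summit.QuantumFields.BalabanUV.Beta.CapWordListGL
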